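import Mathlib.RingTheory.DiscreteValuationRing.Basic
import Mathlib.RingTheory.HopkinsLevitzki
import Mathlib.RingTheory.Ideal.Quotient.Noetherian
import HarnessLib

/-!
# The truncation levels `O ⧸ 𝔪ᵏ⁺¹` of a DVR: local, Artinian, and the annihilator of `ϖᵏ` in `O ⧸ 𝔪ᵏ⁺¹` is `𝔪`

OURS · L1 W4.5b · EL♮(3) `stmt-ResolutionOfSingularities-20148` · J1c (β) base-ring dictionary · counted 0 (res-type-027 g16).
For the embedded infinitesimal lifting step `Wₙ ↪ Wₙ₊₁` over a DVR `(O, 𝔪 = (ϖ))` the base extension is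
`C' = O ⧸ 𝔪ⁿ⁺² ↠ C = O ⧸ 𝔪ⁿ⁺¹` with kernel `J = 𝔪ⁿ⁺¹C' = (ε)`, `ε = ϖⁿ⁺¹`, and the torsor files
(…NatEmbeddedLiftDifferenceClass/TorsorAction/TorsorLaws/TorsorTransitive/LocalExistence) are fed exactly by:
`hann : ∀ c, ε * c = 0 ↔ c ∈ 𝔪C'`, `hεm : ε ∈ 𝔪C'`, `IsNilpotent 𝔪C'`, `IsLocalRing C'`, `IsArtinianRing C'`, `𝔪C' = maximalIdeal C'`.
[folklore; Hartshorne, Deformation Theory (2010) §6 p.54 conventions]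
-/

namespace Summit.ResolutionOfSingularities.ResolutionOfSingularities.Cruxes.EquisingularLiftNat.Sections.Levels

open IsLocalRing

variable {O : Type*} [CommRing O] [IsDomain O] [IsDiscreteValuationRing O]

/-- `𝔪ᵏ⁺¹ ≠ ⊤`. -/
theorem maximalIdeal_pow_succ_ne_top (k : ℕ) : maximalIdeal O ^ (k + 1) ≠ ⊤ := fun h =>
  (maximalIdeal.isMaximal O).ne_top (top_le_iff.mp (h ▸ Ideal.pow_le_self (Nat.succ_ne_zero k)))

/-- `O ⧸ 𝔪ᵏ⁺¹` is nontrivial. -/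
theorem nontrivial_quotient (k : ℕ) : Nontrivial (O ⧸ maximalIdeal O ^ (k + 1)) :=
  ⟨⟨0, 1, fun h => maximalIdeal_pow_succ_ne_top (O := O) k
    ((Ideal.eq_top_iff_one _).mpr (Ideal.Quotient.eq_zero_iff_mem.mp h.symm))⟩⟩

/-- `O ⧸ 𝔪ᵏ⁺¹` is a local ring. -/
theorem isLocalRing_quotient (k : ℕ) : IsLocalRing (O ⧸ maximalIdeal O ^ (k + 1)) :=
  haveI := nontrivial_quotient (O := O) k
  IsLocalRing.of_surjective' (Ideal.Quotient.mk _) Ideal.Quotient.mk_surjective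

/-- The image `𝔪(O ⧸ 𝔪ᵏ⁺¹)` of the maximal ideal is the maximal ideal of the (local) quotient. -/
theorem map_maximalIdeal_eq (k : ℕ) :
    (maximalIdeal O).map (Ideal.Quotient.mk (maximalIdeal O ^ (k + 1))) =
      @maximalIdeal _ _ (isLocalRing_quotient (O := O) k) := by
  letI := isLocalRing_quotient (O := O) k
  have hmax : ((maximalIdeal O).map (Ideal.Quotient.mk (maximalIdeal O ^ (k + 1)))).IsMaximal := by
    refine (Ideal.map_eq_top_or_isMaximal_of_surjective _ Ideal.Quotient.mk_surjective
      (maximalIdeal.isMaximal O)).resolve_left fun h => ?_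
    have h1 : Ideal.Quotient.mk (maximalIdeal O ^ (k + 1)) 1 ∈
        (maximalIdeal O).map (Ideal.Quotient.mk (maximalIdeal O ^ (k + 1))) := h ▸ Submodule.mem_top
    rw [Ideal.mem_quotient_iff_mem_sup,
      sup_eq_left.mpr (Ideal.pow_le_self (Nat.succ_ne_zero k) : maximalIdeal O ^ (k + 1) ≤ maximalIdeal O)] at h1
    exact (maximalIdeal.isMaximal O).ne_top ((Ideal.eq_top_iff_one _).mpr h1)
  exact IsLocalRing.eq_maximalIdeal hmax

/-- `𝔪(O ⧸ 𝔪ᵏ⁺¹)` is nilpotent. -/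
theorem isNilpotent_map_maximalIdeal (k : ℕ) :
    IsNilpotent ((maximalIdeal O).map (Ideal.Quotient.mk (maximalIdeal O ^ (k + 1)))) :=
  ⟨k + 1, by rw [← Ideal.map_pow, Ideal.map_quotient_self, Ideal.zero_eq_bot]⟩

/-- `O ⧸ 𝔪ᵏ⁺¹` is Artinian. -/
theorem isArtinianRing_quotient (k : ℕ) : IsArtinianRing (O ⧸ maximalIdeal O ^ (k + 1)) := by
  letI := isLocalRing_quotient (O := O) k
  rw [isArtinianRing_iff_isNilpotent_maximalIdeal, ← map_maximalIdeal_eq]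
  exact isNilpotent_map_maximalIdeal k

/-- A positive power of a uniformizer lies in `𝔪(O ⧸ 𝔪ᵏ⁺¹)`. -/
theorem mk_pow_succ_mem_map {ϖ : O} (hϖ : Irreducible ϖ) (k j : ℕ) :
    Ideal.Quotient.mk (maximalIdeal O ^ (k + 1)) (ϖ ^ (j + 1)) ∈
      (maximalIdeal O).map (Ideal.Quotient.mk (maximalIdeal O ^ (k + 1))) :=
  Ideal.mem_map_of_mem _ (Ideal.pow_le_self (Nat.succ_ne_zero j)
    (Ideal.pow_mem_pow ((Irreducible.maximalIdeal_eq hϖ).symm ▸ Ideal.mem_span_singleton_self ϖ) _))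

/-- **The annihilator clause `hann`.** In `C' = O ⧸ 𝔪ᵏ⁺¹` with `ε = ϖᵏ`: `ε * c = 0 ↔ c ∈ 𝔪C'`. -/
theorem mk_pow_mul_eq_zero_iff {ϖ : O} (hϖ : Irreducible ϖ) (k : ℕ) (c : O ⧸ maximalIdeal O ^ (k + 1)) :
    Ideal.Quotient.mk (maximalIdeal O ^ (k + 1)) (ϖ ^ k) * c = 0 ↔
      c ∈ (maximalIdeal O).map (Ideal.Quotient.mk (maximalIdeal O ^ (k + 1))) := by
  obtain ⟨a, rfl⟩ := Ideal.Quotient.mk_surjective c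
  rw [← map_mul, Ideal.Quotient.eq_zero_iff_mem, Ideal.mem_quotient_iff_mem_sup,
    sup_eq_left.mpr (Ideal.pow_le_self (Nat.succ_ne_zero k) : maximalIdeal O ^ (k + 1) ≤ maximalIdeal O),
    Irreducible.maximalIdeal_eq hϖ, Ideal.span_singleton_pow, Ideal.mem_span_singleton,
    Ideal.mem_span_singleton, pow_succ]
  exact mul_dvd_mul_iff_left (pow_ne_zero k hϖ.ne_zero)

/-- The kernel `J = 𝔪ᵏ(O ⧸ 𝔪ᵏ⁺¹)` of the level transition is principal, generated by `ε = ϖᵏ`. -/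
theorem map_pow_eq_span_mk_pow {ϖ : O} (hϖ : Irreducible ϖ) (k : ℕ) :
    (maximalIdeal O ^ k).map (Ideal.Quotient.mk (maximalIdeal O ^ (k + 1))) =
      Ideal.span {Ideal.Quotient.mk (maximalIdeal O ^ (k + 1)) (ϖ ^ k)} := by
  have hk : maximalIdeal O ^ k = Ideal.span {ϖ ^ k} := by
    rw [Irreducible.maximalIdeal_eq hϖ, Ideal.span_singleton_pow]
  rw [hk, Ideal.map_span, Set.image_singleton]

/-- The kernel of the transition `O ⧸ 𝔪ᵏ⁺¹ ↠ O ⧸ 𝔪ᵏ` (as `Ideal.Quotient.factor`) is `𝔪ᵏ(O ⧸ 𝔪ᵏ⁺¹)`. -/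
theorem ker_factor_eq_map_pow (k : ℕ) :
    RingHom.ker (Ideal.Quotient.factor (Ideal.pow_le_pow_right (Nat.le_succ k) :
        maximalIdeal O ^ (k + 1) ≤ maximalIdeal O ^ k)) =
      (maximalIdeal O ^ k).map (Ideal.Quotient.mk (maximalIdeal O ^ (k + 1))) := by
  apply le_antisymm
  · rintro x hx
    obtain ⟨a, rfl⟩ := Ideal.Quotient.mk_surjective x
    rw [RingHom.mem_ker, Ideal.Quotient.factor_mk, Ideal.Quotient.eq_zero_iff_mem] at hx
    exact Ideal.mem_map_of_mem _ hx
  · rw [Ideal.map_le_iff_le_comap]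
    intro a ha
    rw [Ideal.mem_comap, RingHom.mem_ker, Ideal.Quotient.factor_mk, Ideal.Quotient.eq_zero_iff_mem]
    exact ha

end Summit.ResolutionOfSingularities.ResolutionOfSingularities.Cruxes.EquisingularLiftNat.Sections.Levels
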